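import Mathlib
import Literature.NumberTheory.Transcendental.MasserWronskian
import HarnessLib

/-!
# Transcendence measure for `e` (Nesterenko–Waldschmidt 1996) — III: the multiplicity estimate

Topic `Literature/NumberTheory/Transcendental`; sibling proof file of
`ExpOneTranscendenceMeasure.lean` (the named fact
`Literature.NumberTheory.Transcendental.NesterenkoWaldschmidt1996_thm_4_2`). Everything here is
PROVED; the only definition is the operator `NW1996.twist w = ∂ + w` (a `LinearMap`).

This part is Lemma 2 of [NesterenkoWaldschmidt1996, §2] (a variant of the zero estimate of
Laurent–Mignotte–Nesterenko 1995), in the following coordinate form. For a field `K` of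
characteristic zero, a polynomial `P(X, Y) = ∑ᵢ Qᵢ(X) Y^{kᵢ}` and `δ = ∂/∂X + β Y ∂/∂Y` one has
`δ^σ P = ∑ᵢ ((∂ + wᵢ)^σ Qᵢ)(X) Y^{kᵢ}` with `wᵢ = β kᵢ`; so the values `δ^σ P(ξ_μ, η_μ)` are
`Λ_{σ,μ} = ∑ᵢ ((∂ + wᵢ)^σ Qᵢ)(ξ_μ) · y_{μ,i}` with `y_{μ,i} = η_μ^{kᵢ} ≠ 0`. Lemma 2 then reads:

* `NW1996.multiplicity_estimate`: let `wᵢ ∈ K` (`i ∈ ι`) be pairwise distinct, `Qᵢ ∈ K[X]` not all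
  zero of degree `≤ D₀`, `ξ₁, …, ξ_M ∈ K` pairwise distinct and `y_{μ,i} ≠ 0`. If `Λ_{σ,μ} = 0` for
  all `μ` and all `σ < S`, then `S·M ≤ |ι|·D₀ + (|ι| - 1)·M` (i.e. `(S - n) M ≤ (n+1) D₀` with
  `n + 1 = |ι| = D₁ + 1`, which is the inequality contradicting (2.1)).

Proof as printed (pp. 2–3 of the arXiv version): restrict to the `n + 1` indices with `Qᵢ ≠ 0`;
the determinant `Δ(X) = det((∂ + wᵢ)^σ Qᵢ)_{0 ≤ σ ≤ n, i}` has top coefficient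
`∏ bᵢ · Vandermonde(wᵢ) ≠ 0` (`NW1996.det_twistMatrix_ne_zero`); by Cramer
`Δ · e_i = ∑_σ Δ_σ · (row σ)`, and applying `(∂ + wᵢ)^τ` (twisted Leibniz rule
`NW1996.twist_pow_mul`) and evaluating at `ξ_μ` shows `Δ^{(τ)}(ξ_μ) = 0` for `τ < S - n`; counting
roots with multiplicity gives `(S - n) M ≤ deg Δ ≤ (n+1) D₀`.

## References

* [NesterenkoWaldschmidt1996] Yu. V. Nesterenko, M. Waldschmidt, *On the approximation of the values
  of exponential function and logarithm by algebraic numbers*, Mat. Zapiski 2 (1996), 23–42;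
  arXiv:math/0002047, §2 Lemma 2.
* M. Laurent, M. Mignotte, Yu. Nesterenko, *Formes linéaires en deux logarithmes et déterminants
  d'interpolation*, J. Number Theory 55 (1995), 285–321 (the model zero estimate; not held).
-/

noncomputable section

open Polynomial Finset

namespace Literature.NumberTheory.Transcendental

namespace NW1996

variable {K : Type*} [Field K]

/-! ### The twisted derivative `∂ + w` -/

/-- The operator `∂ + w` on `K[X]`: the action of `δ = ∂/∂X + βY∂/∂Y` on the coefficient of
`Y^k`, `w = βk` ([NesterenkoWaldschmidt1996, §2, (2.3)]). [cite: NesterenkoWaldschmidt1996, §2] -/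
def twist (w : K) : K[X] →ₗ[K] K[X] := derivative + LinearMap.mulLeft K (C w)

/-- `(∂ + w) p = p' + w p`. [folklore] -/
theorem twist_apply (w : K) (p : K[X]) : twist w p = derivative p + C w * p := rfl

/-- `(∂ + w)^{τ+1} p = (∂ + w)((∂ + w)^τ p)`. [folklore] -/
theorem twist_pow_succ (w : K) (τ : ℕ) (p : K[X]) :
    (twist w ^ (τ + 1)) p = twist w ((twist w ^ τ) p) := by
  rw [pow_succ', Module.End.mul_apply]

/-- Degrees do not increase: `deg (∂ + w) p ≤ deg p`. [folklore] -/
theorem natDegree_twist_le {w : K} {p : K[X]} {m : ℕ} (h : p.natDegree ≤ m) :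
    (twist w p).natDegree ≤ m := by
  rw [twist_apply]
  exact natDegree_add_le_of_degree_le ((natDegree_derivative_le p).trans (by omega))
    ((natDegree_C_mul_le _ _).trans h)

/-- The coefficient of `X^m`, `m ≥ deg p`, is multiplied by `w`. [folklore] -/
theorem coeff_twist {w : K} {p : K[X]} {m : ℕ} (h : p.natDegree ≤ m) :
    (twist w p).coeff m = w * p.coeff m := by
  rw [twist_apply, coeff_add, coeff_derivative, coeff_C_mul,
    coeff_eq_zero_of_natDegree_lt (by omega : p.natDegree < m + 1), zero_mul, zero_add]

/-- `deg (∂ + w)^τ p ≤ deg p`. [folklore] -/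
theorem natDegree_twist_pow_le (w : K) {p : K[X]} {m : ℕ} (h : p.natDegree ≤ m) (τ : ℕ) :
    ((twist w ^ τ) p).natDegree ≤ m := by
  induction τ with
  | zero => simpa using h
  | succ τ ih => rw [twist_pow_succ]; exact natDegree_twist_le ih

/-- The coefficient of `X^m` in `(∂ + w)^τ p` is `w^τ · (coeff of X^m in p)`
([NesterenkoWaldschmidt1996, §2]: `Q_{σ i} = b_i (β k_i)^σ X^{m_i} + ⋯`).
[cite: NesterenkoWaldschmidt1996, §2] -/
theorem coeff_twist_pow (w : K) {p : K[X]} {m : ℕ} (h : p.natDegree ≤ m) (τ : ℕ) :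
    ((twist w ^ τ) p).coeff m = w ^ τ * p.coeff m := by
  induction τ with
  | zero => simp
  | succ τ ih =>
    rw [twist_pow_succ, coeff_twist (natDegree_twist_pow_le w h τ), ih, pow_succ]; ring

/-- `∂ + w` on a product: `(∂ + w)(g p) = g' p + g (∂ + w) p`. [folklore] -/
theorem twist_mul (w : K) (g p : K[X]) : twist w (g * p) = derivative g * p + g * twist w p := by
  simp only [twist_apply, derivative_mul]; ring

/-- **Twisted Leibniz rule**: `(∂ + w)^τ (g p) = ∑_{u+v=τ} C(τ,u) g^{(u)} (∂ + w)^v p`. [folklore] -/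
theorem twist_pow_mul (w : K) (g p : K[X]) (τ : ℕ) :
    (twist w ^ τ) (g * p) =
      ∑ ij ∈ antidiagonal τ, τ.choose ij.1 • (derivative^[ij.1] g * (twist w ^ ij.2) p) := by
  induction τ with
  | zero => simp
  | succ τ ih =>
    rw [twist_pow_succ, ih, map_sum,
      Finset.sum_antidiagonal_choose_succ_nsmul (fun i j => derivative^[i] g * (twist w ^ j) p) τ,
      ← Finset.sum_add_distrib]
    refine Finset.sum_congr rfl fun ij hij => ?_
    rw [Finset.HasAntidiagonal.mem_antidiagonal] at hij
    rw [map_nsmul, twist_mul, ← Function.iterate_succ_apply' derivative, ← twist_pow_succ,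
      Nat.choose_symm_of_eq_add hij.symm, smul_add, add_comm]

/-- `(∂ + w)^v 1 = w^v`. [folklore] -/
theorem twist_pow_one (w : K) (v : ℕ) : (twist w ^ v) (1 : K[X]) = C (w ^ v) := by
  induction v with
  | zero => simp
  | succ v ih => rw [twist_pow_succ, ih, twist_apply, derivative_C, zero_add, ← C_mul, ← pow_succ']

/-- Shifting the exponent: `(∂ + w)^v ((∂ + w)^σ p) = (∂ + w)^{σ + v} p`. [folklore] -/
theorem twist_pow_twist_pow (w : K) (v σ : ℕ) (p : K[X]) :
    (twist w ^ v) ((twist w ^ σ) p) = (twist w ^ (σ + v)) p := by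
  rw [← Module.End.mul_apply, ← pow_add, Nat.add_comm σ v]

/-! ### The determinant `Δ` (degrees and top coefficients via `Masser1975.coeff_prod_of_natDegree_le'`) -/

/-- **The determinant `Δ` is non-zero** ([NesterenkoWaldschmidt1996, §2, p. 3]): for `Qᵢ ≠ 0`
(`i ∈ ι`), `wᵢ` pairwise distinct and any bijection `e : ι ≃ Fin N`, the matrix
`((∂ + wᵢ)^{e j} Qᵢ)_{j,i}` has determinant of degree `≤ ∑ deg Qᵢ` whose coefficient of
`X^{∑ deg Qᵢ}` is `∏ bᵢ · det(wᵢ^{e j}) ≠ 0` (a Vandermonde determinant).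
[cite: NesterenkoWaldschmidt1996, §2 Lemma 2] -/
theorem det_twistMatrix_ne_zero {ι : Type*} [Fintype ι] [DecidableEq ι] (w : ι → K)
    (hw : Function.Injective w) (Q : ι → K[X]) (hQ : ∀ i, Q i ≠ 0) (e : ι ≃ Fin (Fintype.card ι)) :
    (Matrix.det (Matrix.of fun j i => (twist (w i) ^ (e j : ℕ)) (Q i))).natDegree ≤
        ∑ i, (Q i).natDegree ∧
      Matrix.det (Matrix.of fun j i => (twist (w i) ^ (e j : ℕ)) (Q i)) ≠ 0 := by
  classical
  set B : Matrix ι ι K[X] := Matrix.of fun j i => (twist (w i) ^ (e j : ℕ)) (Q i) with hB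
  set mtot := ∑ i, (Q i).natDegree with hmtot
  -- each term of the Leibniz expansion
  have hterm : ∀ π : Equiv.Perm ι,
      (∏ i, B (π i) i).natDegree ≤ mtot ∧
        (∏ i, B (π i) i).coeff mtot = ∏ i, (w i ^ (e (π i) : ℕ) * (Q i).leadingCoeff) := by
    intro π
    have hdegs : ∀ i ∈ (Finset.univ : Finset ι), (B (π i) i).natDegree ≤ (Q i).natDegree :=
      fun i _ => by simp only [hB, Matrix.of_apply]; exact natDegree_twist_pow_le _ le_rfl _
    refine ⟨(natDegree_prod_le _ _).trans (Finset.sum_le_sum hdegs), ?_⟩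
    rw [Masser1975.coeff_prod_of_natDegree_le' _ _ _ hdegs]
    refine Finset.prod_congr rfl fun i _ => ?_
    simp only [hB, Matrix.of_apply]
    rw [coeff_twist_pow _ le_rfl, coeff_natDegree]
  have hdeg : B.det.natDegree ≤ mtot := by
    rw [Matrix.det_apply']
    refine natDegree_sum_le_of_forall_le _ _ fun π _ => ?_
    rw [← map_intCast (C : K →+* K[X])]
    exact (natDegree_C_mul_le _ _).trans (hterm π).1
  refine ⟨hdeg, fun hdet => ?_⟩
  -- the top coefficient
  have hcoeff : B.det.coeff mtot =
      Matrix.det (Matrix.of fun j i => w i ^ (e j : ℕ) * (Q i).leadingCoeff) := by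
    rw [Matrix.det_apply', Matrix.det_apply', finsetSum_coeff]
    refine Finset.sum_congr rfl fun π _ => ?_
    rw [← map_intCast (C : K →+* K[X]), coeff_C_mul, (hterm π).2]
    rfl
  have hvdm : Matrix.det (Matrix.of fun j i => w i ^ (e j : ℕ) * (Q i).leadingCoeff) ≠ 0 := by
    have hrw : (Matrix.of fun j i => w i ^ (e j : ℕ) * (Q i).leadingCoeff) =
        Matrix.of fun j i => (Q i).leadingCoeff * (Matrix.of fun j i => w i ^ (e j : ℕ)) j i := by
      ext j i; simp [mul_comm]
    rw [hrw, Matrix.det_mul_row]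
    refine mul_ne_zero (Finset.prod_ne_zero_iff.mpr fun i _ => leadingCoeff_ne_zero.mpr (hQ i)) ?_
    -- a Vandermonde determinant
    set v : Fin (Fintype.card ι) → K := fun a => w (e.symm a) with hv
    have hvinj : Function.Injective v := hw.comp e.symm.injective
    have hW : (Matrix.of fun j i => w i ^ (e j : ℕ)) =
        ((Matrix.vandermonde v).transpose).submatrix e e := by
      ext j i
      simp [Matrix.vandermonde_apply, hv]
    rw [hW, Matrix.det_submatrix_equiv_self, Matrix.det_transpose]
    exact Matrix.det_vandermonde_ne_zero_iff.mpr hvinj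
  apply hvdm
  rw [← hcoeff, hdet, coeff_zero]

/-! ### Counting zeros with multiplicity -/

/-- If a non-zero polynomial vanishes to order `≥ k` at `M` distinct points then `k·M ≤ deg`.
[folklore] -/
theorem mul_card_le_natDegree_of_rootMultiplicity (Δ : K[X]) {M : ℕ} (ξ : Fin M → K)
    (hξ : Function.Injective ξ) (k : ℕ) (hk : ∀ m, k ≤ Δ.rootMultiplicity (ξ m)) :
    k * M ≤ Δ.natDegree := by
  classical
  set U : Multiset K := k • (Finset.univ : Finset (Fin M)).val.map ξ with hU
  have hle : U ≤ Δ.roots := by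
    rw [Multiset.le_iff_count]
    intro x
    rw [hU, Multiset.count_nsmul, count_roots]
    by_cases hx : x ∈ (Finset.univ : Finset (Fin M)).val.map ξ
    · obtain ⟨m, -, rfl⟩ := Multiset.mem_map.mp hx
      rw [Multiset.count_map_eq_count' ξ _ hξ, Multiset.count_univ, mul_one]
      exact hk m
    · rw [Multiset.count_eq_zero.mpr hx, mul_zero]; exact Nat.zero_le _
  have hcard := Multiset.card_le_card hle
  rw [hU, Multiset.card_nsmul, Multiset.card_map, Finset.card_val, Finset.card_univ,
    Fintype.card_fin] at hcard
  exact hcard.trans (card_roots' Δ)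

/-- Vanishing of derivatives from vanishing of twisted derivatives: if
`((∂ + w)^τ Δ)(x) = 0` for all `τ < k` then `Δ^{(τ)}(x) = 0` for all `τ < k`. [folklore] -/
theorem iterate_derivative_eval_eq_zero_of_twist (w : K) (Δ : K[X]) (x : K) (k : ℕ)
    (h : ∀ τ < k, ((twist w ^ τ) Δ).eval x = 0) : ∀ τ < k, (derivative^[τ] Δ).eval x = 0 := by
  intro τ
  induction τ using Nat.strong_induction_on with
  | _ τ ih =>
    intro hτ
    have key := h τ hτ
    have hexp : (twist w ^ τ) Δ =
        ∑ ij ∈ antidiagonal τ, τ.choose ij.1 • (derivative^[ij.1] Δ * C (w ^ ij.2)) := by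
      conv_lhs => rw [← mul_one Δ]
      rw [twist_pow_mul]
      simp_rw [twist_pow_one]
    rw [hexp, eval_finsetSum, Finset.Nat.sum_antidiagonal_eq_sum_range_succ_mk,
      Finset.sum_range_succ] at key
    have hrest : ∑ u ∈ range τ, eval x (τ.choose (u, τ - u).1 •
        (derivative^[(u, τ - u).1] Δ * C (w ^ (u, τ - u).2))) = 0 := by
      refine Finset.sum_eq_zero fun u hu => ?_
      have hu' : u < τ := Finset.mem_range.mp hu
      simp only [eval_smul, eval_mul, eval_C, ih u hu' (hu'.trans hτ), zero_mul, smul_zero]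
    rw [hrest, zero_add] at key
    simpa [Nat.sub_self, eval_smul, eval_mul] using key

/-! ### The multiplicity estimate -/

variable [CharZero K]

/-- **Multiplicity estimate** ([NesterenkoWaldschmidt1996, §2, Lemma 2], after
Laurent–Mignotte–Nesterenko 1995), coordinate form. Let `K` be a field of characteristic `0`,
`wᵢ ∈ K` (`i ∈ ι`) pairwise distinct, `Qᵢ ∈ K[X]` not all zero with `deg Qᵢ ≤ D₀`,
`ξ₁, …, ξ_M ∈ K` pairwise distinct, `y_{μ,i} ∈ K` non-zero, and put
`Λ_{σ,μ} = ∑ᵢ ((∂ + wᵢ)^σ Qᵢ)(ξ_μ) y_{μ,i}` (`= δ^σ P(ξ_μ, η_μ)` for `P = ∑ Qᵢ Y^{kᵢ}`,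
`wᵢ = β kᵢ`, `y_{μ,i} = η_μ^{kᵢ}`). If `Λ_{σ,μ} = 0` for all `μ` and `0 ≤ σ < S`, then
`S · M ≤ |ι| · D₀ + (|ι| - 1) · M`. In particular there is no such non-zero `P` when
`S M > (D₀ + M)(D₁ + 1)`, `|ι| = D₁ + 1` (condition (2.1)).
[cite: NesterenkoWaldschmidt1996, §2 Lemma 2] -/
theorem multiplicity_estimate {ι : Type*} [Fintype ι] [DecidableEq ι] (w : ι → K)
    (hw : Function.Injective w) (Q : ι → K[X]) (hQ : ∃ i, Q i ≠ 0) {D₀ : ℕ}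
    (hdeg : ∀ i, (Q i).natDegree ≤ D₀) {M : ℕ} (ξ : Fin M → K) (hξ : Function.Injective ξ)
    (y : Fin M → ι → K) (hy : ∀ m i, y m i ≠ 0) {S : ℕ}
    (hvanish : ∀ m, ∀ σ < S, ∑ i, ((twist (w i) ^ σ) (Q i)).eval (ξ m) * y m i = 0) :
    S * M ≤ Fintype.card ι * D₀ + (Fintype.card ι - 1) * M := by
  classical
  -- the support
  set ι' := {i : ι // Q i ≠ 0} with hι'
  obtain ⟨i₀, hi₀⟩ := hQ
  haveI : Nonempty ι' := ⟨⟨i₀, hi₀⟩⟩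
  set N := Fintype.card ι' with hN
  have hNpos : 0 < N := Fintype.card_pos
  have hNle : N ≤ Fintype.card ι := Fintype.card_subtype_le _
  -- restricted data
  set w' : ι' → K := fun i => w i.1 with hw'
  set Q' : ι' → K[X] := fun i => Q i.1 with hQ'
  have hw'inj : Function.Injective w' := fun a b h => Subtype.ext (hw h)
  have hQ'ne : ∀ i, Q' i ≠ 0 := fun i => i.2
  set e : ι' ≃ Fin N := Fintype.equivFin ι'
  -- the vanishing sums over the support
  have hvanish' : ∀ m, ∀ σ < S, ∑ i : ι', ((twist (w' i) ^ σ) (Q' i)).eval (ξ m) * y m i.1 = 0 := by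
    intro m σ hσ
    have h := hvanish m σ hσ
    rw [← Finset.sum_filter_of_ne (p := fun i => Q i ≠ 0) (fun i _ hne => by
      intro hQi; apply hne; simp [hQi])] at h
    rw [Finset.sum_subtype (Finset.univ.filter fun i => Q i ≠ 0) (p := fun i => Q i ≠ 0)
      (fun i => by simp)] at h
    exact h
  -- the matrix and its determinant
  set B : Matrix ι' ι' K[X] := Matrix.of fun j i => (twist (w' i) ^ (e j : ℕ)) (Q' i) with hB
  obtain ⟨hdegΔ, hΔ⟩ := det_twistMatrix_ne_zero w' hw'inj Q' hQ'ne e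
  set Δ := B.det with hΔdef
  have hdegΔ' : Δ.natDegree ≤ N * D₀ := by
    refine hdegΔ.trans ?_
    calc ∑ i : ι', (Q' i).natDegree ≤ ∑ _i : ι', D₀ := Finset.sum_le_sum fun i _ => hdeg i.1
      _ = N * D₀ := by rw [Finset.sum_const, Finset.card_univ, smul_eq_mul]
  -- Cramer: `∑_j adj i j * B j i' = δ_{i i'} Δ`
  have hcramer : ∀ i i' : ι', ∑ j, B.adjugate i j * B j i' = if i = i' then Δ else 0 := by
    intro i i'
    have h := congrFun (congrFun (Matrix.adjugate_mul B) i) i'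
    rw [Matrix.mul_apply] at h
    rw [h, Matrix.smul_apply, Matrix.one_apply, smul_eq_mul, mul_ite, mul_one, mul_zero]
  -- the twisted derivatives of `Δ` vanish at the points
  have htwistΔ : ∀ (i : ι') (m : Fin M) (τ : ℕ), τ + (N - 1) < S →
      ((twist (w' i) ^ τ) Δ).eval (ξ m) = 0 := by
    intro i m τ hτ
    -- apply `(∂ + w_{i'})^τ` to the Cramer identity for `i'`, evaluate, weight and sum over `i'`
    have hsum : ∑ i' : ι', y m i'.1 * ((twist (w' i') ^ τ) (∑ j, B.adjugate i j * B j i')).eval (ξ m)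
        = y m i.1 * ((twist (w' i) ^ τ) Δ).eval (ξ m) := by
      rw [← Finset.sum_erase_add _ _ (Finset.mem_univ i)]
      rw [hcramer i i, if_pos rfl]
      have h0 : ∑ i' ∈ Finset.univ.erase i,
          y m i'.1 * ((twist (w' i') ^ τ) (∑ j, B.adjugate i j * B j i')).eval (ξ m) = 0 := by
        refine Finset.sum_eq_zero fun i' hi' => ?_
        rw [hcramer i i', if_neg (Finset.ne_of_mem_erase hi').symm, map_zero, eval_zero, mul_zero]
      rw [h0, zero_add]
    have hsum' : ∑ i' : ι', y m i'.1 * ((twist (w' i') ^ τ) (∑ j, B.adjugate i j * B j i')).eval (ξ m)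
        = 0 := by
      -- expand with the twisted Leibniz rule
      have hexp : ∀ i' : ι', ((twist (w' i') ^ τ) (∑ j, B.adjugate i j * B j i')).eval (ξ m) =
          ∑ j, ∑ ij ∈ antidiagonal τ, (τ.choose ij.1 : K) *
            ((derivative^[ij.1] (B.adjugate i j)).eval (ξ m) *
              ((twist (w' i') ^ (e j + ij.2)) (Q' i')).eval (ξ m)) := by
        intro i'
        rw [map_sum, eval_finsetSum]
        refine Finset.sum_congr rfl fun j _ => ?_
        rw [twist_pow_mul, eval_finsetSum]
        refine Finset.sum_congr rfl fun ij _ => ?_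
        simp only [hB, Matrix.of_apply]
        rw [twist_pow_twist_pow, eval_smul, eval_mul, nsmul_eq_mul]
      simp_rw [hexp, Finset.mul_sum]
      rw [Finset.sum_comm]
      refine Finset.sum_eq_zero fun j _ => ?_
      rw [Finset.sum_comm]
      refine Finset.sum_eq_zero fun ij hij => ?_
      have hij' := Finset.HasAntidiagonal.mem_antidiagonal.mp hij
      have hlt : (e j : ℕ) + ij.2 < S := by
        have := (e j).isLt
        omega
      have hv := hvanish' m _ hlt
      calc ∑ i' : ι', y m i'.1 * ((τ.choose ij.1 : K) *
            ((derivative^[ij.1] (B.adjugate i j)).eval (ξ m) *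
              ((twist (w' i') ^ ((e j : ℕ) + ij.2)) (Q' i')).eval (ξ m)))
          = (τ.choose ij.1 : K) * (derivative^[ij.1] (B.adjugate i j)).eval (ξ m) *
              ∑ i' : ι', ((twist (w' i') ^ ((e j : ℕ) + ij.2)) (Q' i')).eval (ξ m) * y m i'.1 := by
            rw [Finset.mul_sum]
            refine Finset.sum_congr rfl fun i' _ => ?_
            ring
        _ = 0 := by rw [hv, mul_zero]
    rw [hsum] at hsum'
    rcases mul_eq_zero.mp hsum' with h | h
    · exact absurd h (hy m i.1)
    · exact h
  -- hence `Δ` vanishes to order `≥ S - (N - 1)` at each `ξ_μ`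
  obtain ⟨i₁⟩ := (inferInstance : Nonempty ι')
  have hderivΔ : ∀ (m : Fin M), ∀ τ < S - (N - 1), (derivative^[τ] Δ).eval (ξ m) = 0 := by
    intro m
    refine iterate_derivative_eval_eq_zero_of_twist (w' i₁) Δ (ξ m) (S - (N - 1)) fun τ hτ => ?_
    exact htwistΔ i₁ m τ (by omega)
  have hmult : ∀ m, S - (N - 1) ≤ Δ.rootMultiplicity (ξ m) := by
    intro m
    rcases Nat.eq_zero_or_pos (S - (N - 1)) with h0 | hpos
    · rw [h0]; exact Nat.zero_le _
    · have h := (lt_rootMultiplicity_iff_isRoot_iterate_derivative hΔ (t := ξ m)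
        (n := S - (N - 1) - 1)).mpr fun u hu => by
          rw [IsRoot.def]; exact hderivΔ m u (by omega)
      omega
  have hcount := mul_card_le_natDegree_of_rootMultiplicity Δ ξ hξ (S - (N - 1)) hmult
  -- arithmetic
  have h1 : (S - (N - 1)) * M ≤ N * D₀ := hcount.trans hdegΔ'
  have h2 : S * M ≤ (S - (N - 1)) * M + (N - 1) * M := by
    rw [← Nat.add_mul]; exact Nat.mul_le_mul_right _ (by omega)
  have h3 : N * D₀ ≤ Fintype.card ι * D₀ := Nat.mul_le_mul_right _ hNle
  have h4 : (N - 1) * M ≤ (Fintype.card ι - 1) * M := Nat.mul_le_mul_right _ (by omega)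
  omega

end NW1996

end Literature.NumberTheory.Transcendental

end
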